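import Literature.NumberTheory.GaloisCohomology.Howard2004.FrobeniusReadoutLagrangianCountProofs
import Literature.NumberTheory.GaloisCohomology.Howard2004.FrobeniusReadoutCharactersProofs
import Literature.NumberTheory.GaloisCohomology.Howard2004.InertLocalPairingSymmetricProofs
import Literature.NumberTheory.GaloisCohomology.Howard2004.StubLocalizationTransferProofs
import Literature.Algebra.Module.LagrangianSubmodulesDeltaTransfer
import HarnessLib

/-!
# Howard 2004, Prop. 1.5.9 at an inert Kolyvagin prime — FROBENIUS form: the Lagrangian transfer and
# «`loc_q(Stub(n)) = 0 ⟹ loc_q(Stub(nq)) = 0`» with the readout binders `hfrob`, `hdet` (NON-FREE level rings; proofs file)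

Topic `NumberTheory/GaloisCohomology/Howard2004`. THEOREMS ONLY: no definition, no named fact, no instance, no
notation, no `sorry`. Cell `pub/bsd-print-x9`, print leaf G87 `thm161_dvrKolyvaginBound` (Howard Thm. 1.6.1); seat
`bsd-line-x9-p1-w4` g16, brick (READ-REBASE) part 4 = the TWIN of `InertLagrangianTransferProofs` §2 and
`InertStubLocalizationTransferProofs` (same seat, bricks (LAGR-LOC-INST), (H159-LOC)).

WHY (x10b-p1-w6 g9 «READ-NONFREE», bsd-line-x10b-p1 LEAD g12 ruling 2026-08-29): the originals carry the dualizing-family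
binder `hbij : Bijective fun x : R => fun i => exp (λ(r_i x))` (`(R, +)` free over `ℤ/p^k`), false at the refined levels
`R/π^e` (`m ∤ e`) of a ramified DVR, through which every level of Lemma 1.6.4 passes.  The twins take instead

  `hfrob : Bijective fun c : R => lamMul lam c`                             (a Frobenius character: (FROB-CHAR)), and
  `hdet  : ∀ v (z : H²(K_v, R(1))), (∀ b : R, H²(exp ∘ λ_b) z = 0) → z = 0`   (H²-detection: (READ-H2)),

both available at every level; `hstab` is quantified over all `b ∈ R`; proofs are otherwise those of the originals
(inputs: `FrobeniusReadoutCharactersProofs.exists_coord_frob`, `FrobeniusReadoutSelfAnnihilatorProofs` («`A = A^⟂`»),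
`RelaxedSelmerLagrangianCountProofs` §2 (hnd), `InertLocalPairingSymmetricProofs` (hsymm), `UnramifiedIsotropy` (hf),
`TransverseIsotropyProofs` (htr), and x9-p1-w3's `StubLocalizationTransferProofs.smul_le_ker_of_smul_le_ker_of_transfer`):

* §2 **`forall_pow_smul_eq_zero_of_inert_local_frob`** — the `htransfer` binder of
  `smul_le_ker_of_smul_le_ker_of_transfer` at an inert Kolyvagin prime;
* §3 **`smul_le_ker_of_smul_le_ker_of_inert_local_frob`** — Prop. 1.5.9 «`loc_q(Stub(n)) = 0 ⟹ loc_q(Stub(nq)) = 0`» for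
  `𝓕(n) = 𝓕.modify 𝒯 ∅ ∅ n`, `q ∉ n`, assembled (the ENGINE's `h159` at the prime `q`, modulo the named binders).

SOURCE. B. Howard, *The Heegner point Kolyvagin system*, Compositio Math. **140** (2004) = arXiv:1202.6340, Prop. 1.5.9
(arXiv Prop. 2.5.9, p. 10 L146 – p. 11 L13) with Lemmas 1.5.6–1.5.8.
NOT HERE: `hfrob`/`hdet` themselves, the decomposition binders (x9-p1-w3's Prop. 1.1.9 files), the datum facts (φI)/(φΛ)/(δ),
H.4 for `𝓕(n)` off `q`; `thm161_dvrKolyvaginBound` is NOT proved; no summit statement is proved; the Birch–Swinnerton-Dyer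
conjecture is not proved by any of this.
References: [Howard2004HeegnerKolyvagin] Prop. 1.5.9, Lemmas 1.5.6–1.5.8, Def. 1.2.2, §1.3 H.4; [MilneADT2006] I Cor. 2.3, Thm. 4.10.
-/

set_option autoImplicit false

noncomputable section

open CategoryTheory Function NumberField IsDedekindDomain Field
open scoped NumberField

namespace Literature.NumberTheory.GaloisCohomology.Howard2004

open Literature.NumberTheory.GaloisRepresentations
open Literature.NumberTheory.GaloisRepresentations.DiscreteGaloisModule

variable {K : Type} [Field K] [NumberField K] {M : Type} [AddCommGroup M] [TopologicalSpace M]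
  [DiscreteTopology M] {R : Type} [CommRing R] [Module R M] [TopologicalSpace R] [DiscreteTopology R]
  {p : ℕ} [Fact p.Prime] [Algebra ℤ_[p] R]

/-! ## §1 The `𝒪`-action through `𝒪 → R` -/

omit [TopologicalSpace R] [DiscreteTopology R] in
/-- **The `𝒪`-action on `H¹` is the `R`-action through `𝒪 → R`**: `H¹(c •) = H¹((algebraMap c) •)` when
`c • m = algebraMap c • m` on the module (`IsScalarTower 𝒪 R M`) — a local copy, for an arbitrary `IsScalarLinear 𝒪`
witness, of `galoisCohomology.scalarMapH1_algebraMap` (`KolyvaginSystemRescalingProofs`, not imported here).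
[cite: Howard2004HeegnerKolyvagin, §1 conventions and §1.6 (arXiv p. 11 L33–38: the level `T^{(k)}` over `R_k = R/𝔪^{e_k}`)] [cite: SerreGaloisCohomology1997, I §2.2] -/
private theorem scalarMapH1_algebraMap'
    {𝒪 : Type} [CommRing 𝒪] [Algebra 𝒪 R] [Module 𝒪 M] [IsScalarTower 𝒪 R M] {F : Type} [Field F]
    (τ : DiscreteGaloisModule F M) (h𝒪 : τ.IsScalarLinear 𝒪) (hR : τ.IsScalarLinear R) (c : 𝒪)
    (x : galoisCohomology τ 1) :
    galoisCohomology.scalarMapH1 τ h𝒪 c x = galoisCohomology.scalarMapH1 τ hR (algebraMap 𝒪 R c) x := by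
  obtain ⟨φ, rfl⟩ := oneCocycleClass_surjective _ x
  rw [galoisCohomology.scalarMapH1_oneCocycleClass, galoisCohomology.scalarMapH1_oneCocycleClass]
  refine congrArg _ (Subtype.ext (ContinuousMap.ext fun σ => ?_))
  rw [galoisCohomology.scalarCocycle_apply, galoisCohomology.scalarCocycle_apply, algebraMap_smul]

namespace DualityDatum

variable {cd : ConjugationDatum K} {ρ : DiscreteGaloisModule K M} [Finite M]
  (D : DualityDatum p cd ρ R) {k : ℕ}
  (lam : R →+ ZMod (p ^ k))
  (hlam : ∀ (z : ℤ_[p]) (r : R), lam (algebraMap ℤ_[p] R z * r) = PadicInt.toZModPow k z * lam r)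
  (exp : ZMod (p ^ k) →+ MuCarrier K (p ^ k))
  (hexp : ∀ (g : absoluteGaloisGroup K) (x : ZMod (p ^ k)),
    exp (cyclotomicCharacterModPow K p k g * x) = mu K (p ^ k) g (exp x))

/-! ## §2 `htransfer` at an inert Kolyvagin prime -/

include hlam hexp in
/-- **Howard 2004, Prop. 1.5.9 at an inert Kolyvagin prime — the Lagrangian transfer `htransfer` from the local
hypotheses.**  See the file header for the setting.  With `V = H¹(K_q, T)` as an `𝒪`-module (`moduleH1` for the DVR
`𝒪` acting through the level ring `R`), `𝒪`-submodules `SA`, `SV_f`, `SV_tr` whose underlying groups are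
`loc_q H¹_𝓡(K, T)`, `H¹_ur(K_q, T)`, `H¹_tr(K_q, T)`, `IsCompl SV_f SV_tr`, and `SV_f, SV_tr ≃ₗ[𝒪] (𝒪/ϖ^k)²`:
if `ϖ^λ` kills `SA ⊓ SV_f` and `2λ' + ℓ_𝒪(SA ⊓ SV_f) = 2λ + ℓ_𝒪(SA ⊓ SV_tr)` then `ϖ^{λ'}` kills `SA ⊓ SV_tr`.
FROBENIUS FORM: the readout
binders are `hfrob` (Frobenius character) and `hdet` (H²-detection at every place), valid for non-free level rings.
PROOF: `forall_pow_smul_eq_zero_of_lagrangian` (Lemmas 1.5.7–1.5.8) for the `𝒪`-bilinear form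
`B'(x, a) = coord(x ∪_e T_q a) : V × V → R` (`exists_coord_frob`), whose hypotheses are the landed Galois inputs: `hA`
(`mem_map_localization_selmerGroup_iff_forall_localCup_cast_eq_zero_frob`), `hnd`
(`eq_zero_of_forall_localCup_transportH1_cast_eq_zero`), `hsymm` (`localCup_transportH1_cast_comm`), `hf`
(`localCup_transportH1_eq_zero_of_mem_unramifiedSubgroup`), `htr` (`localCup_transportH1_eq_zero_of_mem_transverseCondition`),
`hP` (the socle of `R` over `𝒪`).
[cite: Howard2004HeegnerKolyvagin, Prop. 1.5.9 with Lemmas 1.5.6–1.5.8 (arXiv:1202.6340 p. 10 L80 – p. 11 L13)] [cite: MilneADT2006, Ch. I Cor. 2.3 and Thm. 4.10] -/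
theorem forall_pow_smul_eq_zero_of_inert_local_frob
    {𝒪 : Type} [CommRing 𝒪] [IsDomain 𝒪] [IsDiscreteValuationRing 𝒪] [Algebra 𝒪 R] [Module 𝒪 M]
    [IsScalarTower 𝒪 R M] {ϖ : 𝒪} (hϖ : Irreducible ϖ) (h2 : IsUnit (2 : 𝒪))
    (hsoc : ∀ a b : R, ϖ • a = 0 → ϖ • b = 0 → a ≠ 0 → ∃ c : 𝒪, b = c • a)
    (hρ𝒪 : ρ.IsScalarLinear 𝒪) (hρ : ρ.IsScalarLinear R)
    -- the finite module and the readings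
    (hn : ∀ m : M, (p ^ k) • m = 0) (hRp : IsPrimaryTorsion p R)
    (inv : LocalInvariants K (p ^ k)) (hPT : inv.SumLocalTermEqZero) (hSC : inv.SelmerComplement)
    (hperf : inv.IsPerfect) (hΘ : Bijective (D.toTateDual lam hlam exp hexp))
    (hfrob : Bijective fun c : R => lamMul lam c)
    (hdet : ∀ (v : Place K) (z : galoisCohomology (D.twistOne.toLocal v) 2),
      (∀ b : R, cohomologyMap (D.expLamLocalHom (lamMul lam b) (lamMul_semilinear lam hlam b) exp hexp v) 2 z = 0) →
        z = 0)
    -- the global structure relaxed at the inert `q`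
    (S : Finset (Place K))
    (hS : ∀ v : HeightOneSpectrum (𝓞 K), (Sum.inr v : Place K) ∉ S →
      ((p ^ k : ℕ) : 𝓞 K) ∉ v.asIdeal ∧ GaloisRep.IsUnramifiedAt v ρ)
    (𝓕 𝓡 : SelmerStructure ρ) {q : HeightOneSpectrum (𝓞 K)} (hq : cd.σ • q = q)
    (hqS : (Sum.inr q : Place K) ∈ S) (h𝓡S : 𝓡.IsUnramifiedOutside S)
    (hrel : 𝓡 (Sum.inr q) = ⊤)
    (hoff : ∀ v : HeightOneSpectrum (𝓞 K), v ≠ q → 𝓡 (Sum.inr v) = 𝓕 (Sum.inr v))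
    (horth : ∀ v : HeightOneSpectrum (𝓞 K), v ≠ q → D.IsSelfOrthogonalAt 𝓕 v)
    (hstab : ∀ v : HeightOneSpectrum (𝓞 K), v ≠ q → ∀ b : R, ∀ a ∈ 𝓕 (Sum.inr v),
      galoisCohomology.scalarMapH1 (ρ.toLocal (Sum.inr v)) (isScalarLinear_toLocal hρ (Sum.inr v)) b a ∈
        𝓕 (Sum.inr v))
    (hinf : ∀ (w : InfinitePlace K) (c : galoisCohomology ρ 1),
      galoisCohomology.localization ρ (Sum.inl w) 1 c = 0)
    -- the local arithmetic at `q`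
    (ℓ : ℕ) (jbar : AlgebraicClosure K →+* ℂ)
    (htriv : ∀ (g : absoluteGaloisGroup (q.adicCompletion K)) (x : M), GaloisRep.toLocal q ρ g x = x)
    (htriv' : ∀ (g : absoluteGaloisGroup ((cd.σ • q).adicCompletion K)) (x : M), GaloisRep.toLocal (cd.σ • q) ρ g x = x)
    (htrivTw : ∀ (g : absoluteGaloisGroup (q.adicCompletion K)) (x : M), GaloisRep.toLocal q (cd.twist ρ) g x = x)
    (hp : ∀ x : M, ∃ n : ℕ, p ^ n • x = 0) {N : ℕ} (hN : Odd N) (hRN : ∀ r : R, N • r = 0)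
    (hI : ∀ g ∈ absInertia (q.adicCompletion K), cd.φ q g ∈ absInertia ((cd.σ • q).adicCompletion K))
    (hφ : ∀ h ∈ localRingClassSubgroup ℓ jbar q, cd.φ q h ∈ localRingClassSubgroup ℓ jbar (cd.σ • q))
    (σ₀ : absoluteGaloisGroup (q.adicCompletion K))
    (hcyc : ∀ σ, ∃ j : ℕ, (σ₀ ^ j)⁻¹ * σ ∈ localRingClassSubgroup ℓ jbar q)
    (hφI : ∀ g : absoluteGaloisGroup (q.adicCompletion K), ∃ i ∈ absInertia (q.adicCompletion K),
      (hq ▸ cd.φ q g : absoluteGaloisGroup (q.adicCompletion K)) = i * g)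
    (hφΛ : ∀ g : absoluteGaloisGroup (q.adicCompletion K), ∃ l ∈ localRingClassSubgroup ℓ jbar q,
      (hq ▸ cd.φ q g : absoluteGaloisGroup (q.adicCompletion K)) = l * g⁻¹)
    (hδ : ∀ u w : M, D.e u (ρ (cd.δ q) w) = D.e w (ρ (cd.δ q) u)) :
    letI := galoisCohomology.moduleH1 (ρ.toLocal (Sum.inr q)) (isScalarLinear_toLocal hρ𝒪 (Sum.inr q))
    ∀ (SA SVf SVtr : Submodule 𝒪 (galoisCohomology (ρ.toLocal (Sum.inr q)) 1)),
      SA.toAddSubgroup = 𝓡.selmerGroup.map (galoisCohomology.localization ρ (Sum.inr q) 1) →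
      SVf.toAddSubgroup = unramifiedSubgroup (GaloisRep.toLocal q ρ) 1 →
      SVtr.toAddSubgroup = transverseCondition p ρ ℓ jbar q →
      IsCompl SVf SVtr →
      ∀ {kk : ℕ}, Nonempty (↥SVf ≃ₗ[𝒪] (Fin 2 → 𝒪 ⧸ Ideal.span {ϖ ^ kk})) →
        Nonempty (↥SVtr ≃ₗ[𝒪] (Fin 2 → 𝒪 ⧸ Ideal.span {ϖ ^ kk})) →
      ∀ {lam₁ lam₂ : ℕ}, (∀ a ∈ SA ⊓ SVf, ϖ ^ lam₁ • a = 0) →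
        2 * (lam₂ : ℕ∞) + Module.length 𝒪 ↥(SA ⊓ SVf) = 2 * (lam₁ : ℕ∞) + Module.length 𝒪 ↥(SA ⊓ SVtr) →
        ∀ a ∈ SA ⊓ SVtr, ϖ ^ lam₂ • a = 0 := by
  letI := galoisCohomology.moduleH1 (ρ.toLocal (Sum.inr q)) (isScalarLinear_toLocal hρ𝒪 (Sum.inr q))
  intro SA SVf SVtr hSA hSVf hSVtr hc kk hef hetr lam₁ lam₂ hlam₁ hlen
  obtain ⟨ef⟩ := hef
  obtain ⟨etr⟩ := hetr
  -- the coordinate function on `H²(K_q, R(1))`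
  obtain ⟨coord, hcoord, hadd, hsmulR, hzero⟩ :=
    D.exists_coord_frob lam hlam exp hexp hfrob (Sum.inr q) (hdet (Sum.inr q)) (inv (Sum.inr q)) (hperf q).1.1
  -- shorthand for the transported class at the inert `q` (a local notation, not a definition)
  have hT_add : ∀ y y' : galoisCohomology (ρ.toLocal (Sum.inr q)) 1,
      cd.transportH1 ρ q (hq.symm ▸ (y + y') : galoisCohomology (ρ.toLocal (Sum.inr (cd.σ • q))) 1) =
        cd.transportH1 ρ q (hq.symm ▸ y : galoisCohomology (ρ.toLocal (Sum.inr (cd.σ • q))) 1) +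
          cd.transportH1 ρ q (hq.symm ▸ y' : galoisCohomology (ρ.toLocal (Sum.inr (cd.σ • q))) 1) :=
    cd.transportH1_cast_add ρ hq
  -- `𝒪`-scalars act through `R` on `H¹(K_q, T)`
  have hsmulV : ∀ (c : 𝒪) (x : galoisCohomology (ρ.toLocal (Sum.inr q)) 1),
      c • x = galoisCohomology.scalarMapH1 (ρ.toLocal (Sum.inr q)) (isScalarLinear_toLocal hρ (Sum.inr q))
        (algebraMap 𝒪 R c) x := fun c x =>
    scalarMapH1_algebraMap' (ρ.toLocal (Sum.inr q)) (isScalarLinear_toLocal hρ𝒪 (Sum.inr q))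
      (isScalarLinear_toLocal hρ (Sum.inr q)) c x
  -- the `𝒪`-bilinear form `B'(x, a) = coord (x ∪_e T_q a)`
  let B' : galoisCohomology (ρ.toLocal (Sum.inr q)) 1 →ₗ[𝒪] galoisCohomology (ρ.toLocal (Sum.inr q)) 1 →ₗ[𝒪] R :=
    LinearMap.mk₂ 𝒪
      (fun x a => coord (D.localCup (Sum.inr q) x
        (cd.transportH1 ρ q (hq.symm ▸ a : galoisCohomology (ρ.toLocal (Sum.inr (cd.σ • q))) 1))))
      (fun x x' a => by
        change coord _ = coord _ + coord _
        rw [map_add, AddMonoidHom.add_apply, hadd])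
      (fun c x a => by
        change coord _ = c • coord _
        rw [hsmulV, D.localCup_scalarMapH1_left (Sum.inr q) (isScalarLinear_toLocal hρ (Sum.inr q)), hsmulR,
          Algebra.smul_def])
      (fun x a a' => by
        change coord _ = coord _ + coord _
        rw [hT_add, map_add, hadd])
      (fun c x a => by
        change coord _ = c • coord _
        rw [hsmulV, cd.transportH1_cast_scalarMapH1 ρ hρ hq,
          D.localCup_scalarMapH1_right (Sum.inr q) (isScalarLinear_toLocal hρ (Sum.inr q))
            (isScalarLinear_twist_toLocal cd hρ (Sum.inr q)), hsmulR, Algebra.smul_def])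
  have hB' : ∀ x a, B' x a = coord (D.localCup (Sum.inr q) x
      (cd.transportH1 ρ q (hq.symm ▸ a : galoisCohomology (ρ.toLocal (Sum.inr (cd.σ • q))) 1))) := fun _ _ => rfl
  -- membership dictionary
  have memA : ∀ x, x ∈ SA ↔ x ∈ 𝓡.selmerGroup.map (galoisCohomology.localization ρ (Sum.inr q) 1) := fun x => by
    rw [← Submodule.mem_toAddSubgroup, hSA]
  have memF : ∀ x, x ∈ SVf ↔ x ∈ unramifiedSubgroup (GaloisRep.toLocal q ρ) 1 := fun x => by
    rw [← Submodule.mem_toAddSubgroup, hSVf]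
    exact Iff.rfl
  have memT : ∀ x, x ∈ SVtr ↔ x ∈ transverseCondition p ρ ℓ jbar q := fun x => by
    rw [← Submodule.mem_toAddSubgroup, hSVtr]
    exact Iff.rfl
  -- the hypotheses of the Lagrangian algebra
  have hdecomp : ∀ x : galoisCohomology (ρ.toLocal (Sum.inr q)) 1,
      ∃ f : galoisCohomology (ρ.toLocal (Sum.inr q)) 1, f ∈ unramifiedSubgroup (GaloisRep.toLocal q ρ) 1 ∧
        ∃ t : galoisCohomology (ρ.toLocal (Sum.inr q)) 1, t ∈ transverseCondition p ρ ℓ jbar q ∧ x = f + t := by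
    intro x
    have hx : x ∈ SVf ⊔ SVtr := by rw [hc.sup_eq_top]; exact Submodule.mem_top
    obtain ⟨f, hf, t, ht, rfl⟩ := Submodule.mem_sup.1 hx
    exact ⟨f, (memF f).1 hf, t, (memT t).1 ht, rfl⟩
  have hsymm' : ∀ x y, B' x y = B' y x := fun x y => by
    rw [hB', hB', D.localCup_transportH1_cast_comm hRp ℓ jbar hq htriv htriv' htrivTw hp hN hRN hI hφ σ₀ hcyc hφI
      hφΛ hδ hdecomp x y]
  have hnd' : ∀ x, (∀ y, B' x y = 0) → x = 0 := fun x hx =>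
    D.eq_zero_of_forall_localCup_transportH1_cast_eq_zero lam hlam exp hexp hn hΘ inv hperf hq x fun a =>
      (hzero _).1 (by rw [← hB']; exact hx a)
  have hf' : ∀ x ∈ SVf, ∀ y ∈ SVf, B' x y = 0 := fun x hx y hy => by
    rw [hB', D.localCup_transportH1_eq_zero_of_mem_unramifiedSubgroup hRp q hI ((memF x).1 hx)
      ((cast_mem_unramifiedSubgroup_iff ρ hq.symm y).2 ((memF y).1 hy))]
    exact (hzero 0).2 rfl
  have htr' : ∀ x ∈ SVtr, ∀ y ∈ SVtr, B' x y = 0 := fun x hx y hy => by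
    rw [hB', D.localCup_transportH1_eq_zero_of_mem_transverseCondition ℓ jbar q htriv htriv' htrivTw hp hN hRN σ₀ hcyc
      hφ ((memT x).1 hx) ((cast_mem_transverseCondition_iff ρ p ℓ jbar hq.symm y).2 ((memT y).1 hy))]
    exact (hzero 0).2 rfl
  have hA' : ∀ x, x ∈ SA ↔ ∀ a ∈ SA, B' x a = 0 := fun x => by
    rw [memA, D.mem_map_localization_selmerGroup_iff_forall_localCup_cast_eq_zero_frob lam hlam exp hexp hn hρ inv hPT hSC
      (fun v => (hperf v).1.1) hΘ hdet S hS 𝓕 𝓡 hq hqS h𝓡S hrel hoff horth hstab hinf x]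
    refine ⟨fun h a ha => ?_, fun h a ha => ?_⟩
    · rw [hB', h a ((memA a).1 ha)]; exact (hzero 0).2 rfl
    · exact (hzero _).1 ((hB' x a).symm.trans (h a ((memA a).2 ha)))
  exact Literature.Algebra.Module.forall_pow_smul_eq_zero_of_lagrangian hϖ hsoc B' hsymm' hnd' hc ef etr hf' htr' h2
    SA hA' hlam₁ hlen

/-! ## §3 Prop. 1.5.9 at an inert Kolyvagin prime, assembled (Frobenius form) -/

include hlam hexp in
open scoped Classical in
open Pointwise in
/-- **Howard 2004, Prop. 1.5.9 («`loc_q(Stub(n)) = 0 ⟹ loc_q(Stub(nq)) = 0`») at an inert Kolyvagin prime `q ∉ n`,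
assembled from the local hypotheses — Frobenius form (`hfrob`, `hdet` instead of a dualizing family).**  Setting of `StubLocalizationTransferProofs.smul_le_ker_of_smul_le_ker_of_transfer`
(structures `𝓕(n)`, `𝓕(nq)`, `𝓕_q(n)`, `𝓕^q(n)`; `𝒪`-submodules with those Selmer groups / local conditions as underlying
groups; decompositions `θ₁`, `θ₂`) over the DVR `𝒪` of coefficients acting on `T` through the level ring `R`, plus the
hypotheses of `forall_pow_smul_eq_zero_of_inert_local_frob` for `𝓡 = 𝓕^q(n)` relaxed at `q` and
`𝓕(n)` off `q`, with `𝓕_q = H¹_ur(K_q, T)` and `𝒯_q = H¹_tr(K_q, T)`.  Conclusion: `ϖ^{λ₁} • 𝓗(n) ≤ ker f → ϖ^{λ₂} • 𝓗(nq) ≤ ker f`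
for any `𝒪`-linear `f` agreeing with `loc_q` — the input `h159` of `StubLemmaInductionProofs` at the prime `q`.
[cite: Howard2004HeegnerKolyvagin, Prop. 1.5.9 (arXiv:1202.6340 Prop. 2.5.9, p. 10 L146 – p. 11 L13)] [cite: MilneADT2006, Ch. I Cor. 2.3 and Thm. 4.10] -/
theorem smul_le_ker_of_smul_le_ker_of_inert_local_frob
    {𝒪 : Type} [CommRing 𝒪] [IsDomain 𝒪] [IsDiscreteValuationRing 𝒪] [Algebra 𝒪 R] [Module 𝒪 M]
    [IsScalarTower 𝒪 R M] {ϖ : 𝒪} (hϖ : Irreducible ϖ) (h2 : IsUnit (2 : 𝒪))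
    (hsoc : ∀ a b : R, ϖ • a = 0 → ϖ • b = 0 → a ≠ 0 → ∃ c : 𝒪, b = c • a)
    (hρ𝒪 : ρ.IsScalarLinear 𝒪) (hρ : ρ.IsScalarLinear R)
    (hn : ∀ m : M, (p ^ k) • m = 0) (hRp : IsPrimaryTorsion p R)
    (inv : LocalInvariants K (p ^ k)) (hPT : inv.SumLocalTermEqZero) (hSC : inv.SelmerComplement)
    (hperf : inv.IsPerfect) (hΘ : Bijective (D.toTateDual lam hlam exp hexp))
    (hfrob : Bijective fun c : R => lamMul lam c)
    (hdet : ∀ (v : Place K) (z : galoisCohomology (D.twistOne.toLocal v) 2),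
      (∀ b : R, cohomologyMap (D.expLamLocalHom (lamMul lam b) (lamMul_semilinear lam hlam b) exp hexp v) 2 z = 0) →
        z = 0)
    (S : Finset (Place K))
    (hS : ∀ v : HeightOneSpectrum (𝓞 K), (Sum.inr v : Place K) ∉ S →
      ((p ^ k : ℕ) : 𝓞 K) ∉ v.asIdeal ∧ GaloisRep.IsUnramifiedAt v ρ)
    (𝓕 𝒯 : SelmerStructure ρ) (n : Finset (HeightOneSpectrum (𝓞 K))) {q : HeightOneSpectrum (𝓞 K)}
    (hq : cd.σ • q = q) (hqn : q ∉ n) (hqS : (Sum.inr q : Place K) ∈ S)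
    (h𝓡S : (𝓕.modify 𝒯 {q} ∅ n).IsUnramifiedOutside S)
    (horth : ∀ v : HeightOneSpectrum (𝓞 K), v ≠ q → D.IsSelfOrthogonalAt (𝓕.modify 𝒯 ∅ ∅ n) v)
    (hstab : ∀ v : HeightOneSpectrum (𝓞 K), v ≠ q → ∀ b : R, ∀ a ∈ 𝓕.modify 𝒯 ∅ ∅ n (Sum.inr v),
      galoisCohomology.scalarMapH1 (ρ.toLocal (Sum.inr v)) (isScalarLinear_toLocal hρ (Sum.inr v)) b a ∈
        𝓕.modify 𝒯 ∅ ∅ n (Sum.inr v))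
    (hinf : ∀ (w : InfinitePlace K) (c : galoisCohomology ρ 1),
      galoisCohomology.localization ρ (Sum.inl w) 1 c = 0)
    -- the local arithmetic at `q`
    (ℓ : ℕ) (jbar : AlgebraicClosure K →+* ℂ)
    (h𝓕q : 𝓕 (Sum.inr q) = unramifiedSubgroup (GaloisRep.toLocal q ρ) 1)
    (h𝒯q : 𝒯 (Sum.inr q) = transverseCondition p ρ ℓ jbar q)
    (htriv : ∀ (g : absoluteGaloisGroup (q.adicCompletion K)) (x : M), GaloisRep.toLocal q ρ g x = x)
    (htriv' : ∀ (g : absoluteGaloisGroup ((cd.σ • q).adicCompletion K)) (x : M), GaloisRep.toLocal (cd.σ • q) ρ g x = x)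
    (htrivTw : ∀ (g : absoluteGaloisGroup (q.adicCompletion K)) (x : M), GaloisRep.toLocal q (cd.twist ρ) g x = x)
    (hp : ∀ x : M, ∃ m : ℕ, p ^ m • x = 0) {N : ℕ} (hN : Odd N) (hRN : ∀ r : R, N • r = 0)
    (hI : ∀ g ∈ absInertia (q.adicCompletion K), cd.φ q g ∈ absInertia ((cd.σ • q).adicCompletion K))
    (hφ : ∀ h ∈ localRingClassSubgroup ℓ jbar q, cd.φ q h ∈ localRingClassSubgroup ℓ jbar (cd.σ • q))
    (σ₀ : absoluteGaloisGroup (q.adicCompletion K))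
    (hcyc : ∀ σ, ∃ j : ℕ, (σ₀ ^ j)⁻¹ * σ ∈ localRingClassSubgroup ℓ jbar q)
    (hφI : ∀ g : absoluteGaloisGroup (q.adicCompletion K), ∃ i ∈ absInertia (q.adicCompletion K),
      (hq ▸ cd.φ q g : absoluteGaloisGroup (q.adicCompletion K)) = i * g)
    (hφΛ : ∀ g : absoluteGaloisGroup (q.adicCompletion K), ∃ l ∈ localRingClassSubgroup ℓ jbar q,
      (hq ▸ cd.φ q g : absoluteGaloisGroup (q.adicCompletion K)) = l * g⁻¹)
    (hδ : ∀ u w : M, D.e u (ρ (cd.δ q) w) = D.e w (ρ (cd.δ q) u)) :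
    letI := galoisCohomology.moduleH1 ρ hρ𝒪
    letI := galoisCohomology.moduleH1 (ρ.toLocal (Sum.inr q))
      (hρ𝒪.restrictField (Place.Completion (Sum.inr q)))
    ∀ (f : galoisCohomology ρ 1 →ₗ[𝒪] galoisCohomology (ρ.toLocal (Sum.inr q)) 1)
      (S₁ S₂ S𝓢 : Submodule 𝒪 (galoisCohomology ρ 1))
      (SA SVf SVtr : Submodule 𝒪 (galoisCohomology (ρ.toLocal (Sum.inr q)) 1)),
      (∀ c, f c = galoisCohomology.localization ρ (Sum.inr q) 1 c) →
      S₁.toAddSubgroup = (𝓕.modify 𝒯 ∅ ∅ n).selmerGroup →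
      S₂.toAddSubgroup = (𝓕.modify 𝒯 ∅ ∅ (insert q n)).selmerGroup →
      S𝓢.toAddSubgroup = (𝓕.modify 𝒯 ∅ {q} n).selmerGroup →
      SA.toAddSubgroup = (𝓕.modify 𝒯 {q} ∅ n).selmerGroup.map
        (galoisCohomology.localization ρ (Sum.inr q) 1) →
      SVf.toAddSubgroup = 𝓕 (Sum.inr q) → SVtr.toAddSubgroup = 𝒯 (Sum.inr q) →
      IsCompl SVf SVtr →
      ∀ {kk : ℕ}, Nonempty (↥SVf ≃ₗ[𝒪] (Fin 2 → 𝒪 ⧸ Ideal.span {ϖ ^ kk})) →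
        Nonempty (↥SVtr ≃ₗ[𝒪] (Fin 2 → 𝒪 ⧸ Ideal.span {ϖ ^ kk})) →
      ∀ {Q M₁ M₂ : Type} [AddCommGroup Q] [Module 𝒪 Q] [AddCommGroup M₁] [Module 𝒪 M₁]
        [AddCommGroup M₂] [Module 𝒪 M₂] (ε kQ lam₁ lam₂ : ℕ),
        Nonempty (↥S₁ ≃ₗ[𝒪] (Fin ε → Q) × (M₁ × M₁)) → Nonempty (↥S₂ ≃ₗ[𝒪] (Fin ε → Q) × (M₂ × M₂)) →
        Module.length 𝒪 Q = kQ → Module.length 𝒪 M₁ = lam₁ → Module.length 𝒪 M₂ = lam₂ →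
        ϖ ^ lam₁ • S₁ ≤ LinearMap.ker f → ϖ ^ lam₂ • S₂ ≤ LinearMap.ker f := by
  intro f S₁ S₂ S𝓢 SA SVf SVtr hf hS₁ hS₂ hS𝓢 hSA hSVf hSVtr hc kk hef hetr Q M₁ M₂ _ _ _ _ _ _ ε kQ lam₁ lam₂
    hθ₁ hθ₂ hQ hM₁ hM₂
  have hoff : ∀ v : HeightOneSpectrum (𝓞 K), v ≠ q →
      𝓕.modify 𝒯 {q} ∅ n (Sum.inr v) = 𝓕.modify 𝒯 ∅ ∅ n (Sum.inr v) := fun v hv =>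
    (SelmerStructure.modify_level_eq_relaxed_of_ne 𝓕 𝒯 q n (Sum.inr v) (fun h => hv (Sum.inr_injective h))).symm
  exact smul_le_ker_of_smul_le_ker_of_transfer 𝓕 𝒯 q n hqn hρ𝒪 ϖ f S₁ S₂ S𝓢 SA SVf SVtr hf hS₁ hS₂
    hS𝓢 hSA hSVf hSVtr ε kQ lam₁ lam₂ hθ₁ hθ₂ hQ hM₁ hM₂
    (D.forall_pow_smul_eq_zero_of_inert_local_frob lam hlam exp hexp hϖ h2 hsoc hρ𝒪 hρ hn hRp inv hPT hSC hperf hΘ hfrob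
      hdet S hS (𝓕.modify 𝒯 ∅ ∅ n) (𝓕.modify 𝒯 {q} ∅ n) hq hqS h𝓡S
      (SelmerStructure.modify_relaxed_apply_self 𝓕 𝒯 q n) hoff horth hstab hinf ℓ jbar htriv htriv' htrivTw hp
      hN hRN hI hφ σ₀ hcyc hφI hφΛ hδ SA SVf SVtr hSA (hSVf.trans h𝓕q) (hSVtr.trans h𝒯q) hc hef hetr)

end DualityDatum

end Literature.NumberTheory.GaloisCohomology.Howard2004

end
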